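import Mathlib

/-!
# THEOREM PROD-CF, the abstract half: the cone `K_CF` and the two-generator inequality (p5, gen 16)

mine-3's product theorem for (CF) (`proofs/MINE3-PRODUCT.md` §2b; statement sheet
`proofs/MINE3-PRODUCT-LEANSHEET.md` §A). A GENERATOR is a vector `(z, p, q, n, A, B)` of an ordered
commutative ring, `t := z + p + q + n`; the cone `K_CF` is `0 ≤ z, p, q, n, A, B`, `p ≤ A`, `q ≤ B`,
`n ≤ A + B` (`MemKCF`). For two generators the count triple of their product is
`N = tt' − (z+p)(z'+p') − (z+q)(z'+q') + zz'`, `𝒜 = (t+A)(t'+A') − tt'`, `ℬ = (t+B)(t'+B') − tt'`,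
and PROD-CF is `N ≤ 𝒜 + ℬ`.

* `exists_ray_decomposition` — every generator of `K_CF` is an EXPLICIT nonnegative combination of
  the nine extreme rays `r₁ … r₉` (mine-3's (A2): the coefficients are `z`, `min p (min n A)`, … ;
  here written out in the four cases of the `min`s — no Minkowski–Weyl);
* `prodCF_ray₁ … prodCF_ray₉` — the nine LINEAR facts: the inequality of a generator of `K_CF`
  against each ray;
* **`prodCF_two`** — the two-generator inequality
  `3·tt' + zz' ≤ (z+p)(z'+p') + (z+q)(z'+q') + (t+A)(t'+A') + (t+B)(t'+B')`
  (bilinearity + the decomposition of the second generator); `prodCF_two'` is the same statement in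
  the product coordinates `(T, P, Q, Z, Mₐ, M_b) = (t, z+p, z+q, z, t+A, t+B)`, the form the graph
  side (`C026ProdCFGluing`) uses.

The `k`-generator theorem follows by iterating `prodCF_two` (the product of two generators of `K_CF`
is again in `K_CF`: nonnegativity, monotonicity and `prodCF_two` itself are its three inequalities);
the graph side only ever glues two parts at a time.
-/

namespace PercRepro

namespace ProdCF

variable {K : Type*} [CommRing K] [LinearOrder K] [IsStrictOrderedRing K]

/-- **The cone `K_CF`**: a nonnegative generator `(z, p, q, n, A, B)` with `p ≤ A`, `q ≤ B` and
`n ≤ A + B` (mine-3's three inequalities; for the generator of a marked multigraph the first two are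
set inclusions and the third is (CF) itself). -/
structure MemKCF (z p q n A B : K) : Prop where
  /-- `0 ≤ z` -/
  z_nonneg : 0 ≤ z
  /-- `0 ≤ p` -/
  p_nonneg : 0 ≤ p
  /-- `0 ≤ q` -/
  q_nonneg : 0 ≤ q
  /-- `0 ≤ n` -/
  n_nonneg : 0 ≤ n
  /-- `0 ≤ A` -/
  A_nonneg : 0 ≤ A
  /-- `0 ≤ B` -/
  B_nonneg : 0 ≤ B
  /-- `p ≤ A` -/
  p_le : p ≤ A
  /-- `q ≤ B` -/
  q_le : q ≤ B
  /-- `n ≤ A + B` -/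
  n_le : n ≤ A + B

/-- **The explicit ray decomposition** (mine-3, LEANSHEET (A2)): a generator of `K_CF` is
`c₁·r₁ + … + c₉·r₉` with nonnegative coefficients, for the nine rays
`r₁ = (1,0,0,0,0,0)`, `r₂ = (0,1,0,1,1,0)`, `r₃ = (0,1,0,0,1,0)`, `r₄ = (0,0,1,1,0,1)`,
`r₅ = (0,0,1,0,0,1)`, `r₆ = (0,0,0,1,1,0)`, `r₇ = (0,0,0,1,0,1)`, `r₈ = (0,0,0,0,1,0)`,
`r₉ = (0,0,0,0,0,1)`. The coefficients are mine-3's `z, α, β, γ, δ, ε, φ, ψ, ω`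
(`n_A = min n A`, `α = min p n_A`, `β = p − α`, `ε = n_A − α`, `ψ = A − max p n_A`, and the mirror
on the `b`-side), written out in the four cases `n ≤ A ∧ p ≤ n`, `n ≤ A ∧ n ≤ p`,
`A ≤ n ∧ q ≤ n − A`, `A ≤ n ∧ n − A ≤ q`. -/
theorem exists_ray_decomposition {z p q n A B : K} (h : MemKCF z p q n A B) :
    ∃ c₁ c₂ c₃ c₄ c₅ c₆ c₇ c₈ c₉ : K,
      0 ≤ c₁ ∧ 0 ≤ c₂ ∧ 0 ≤ c₃ ∧ 0 ≤ c₄ ∧ 0 ≤ c₅ ∧ 0 ≤ c₆ ∧ 0 ≤ c₇ ∧ 0 ≤ c₈ ∧ 0 ≤ c₉ ∧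
      z = c₁ ∧ p = c₂ + c₃ ∧ q = c₄ + c₅ ∧ n = c₂ + c₄ + c₆ + c₇ ∧
      A = c₂ + c₃ + c₆ + c₈ ∧ B = c₄ + c₅ + c₇ + c₉ := by
  obtain ⟨hz, hp, hq, hn, hA, hB, hpA, hqB, hnAB⟩ := h
  rcases le_total n A with h₁ | h₁
  · -- `n_A = n`, `n_B = 0`: the `b`-side is `γ = φ = 0`, `δ = q`, `ω = B − q`
    rcases le_total p n with h₂ | h₂
    · -- `α = p`, `β = 0`, `ε = n − p`, `ψ = A − n`
      exact ⟨z, p, 0, 0, q, n - p, 0, A - n, B - q, hz, hp, le_rfl, le_rfl, hq, by linarith,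
        le_rfl, by linarith, by linarith, rfl, by ring, by ring, by ring, by ring, by ring⟩
    · -- `α = n`, `β = p − n`, `ε = 0`, `ψ = A − p`
      exact ⟨z, n, p - n, 0, q, 0, 0, A - p, B - q, hz, hn, by linarith, le_rfl, hq, le_rfl,
        le_rfl, by linarith, by linarith, rfl, by ring, by ring, by ring, by ring, by ring⟩
  · -- `n_A = A`, `n_B = n − A ≤ B`: the `a`-side is `α = p`, `β = 0`, `ε = A − p`, `ψ = 0`
    rcases le_total q (n - A) with h₂ | h₂
    · -- `γ = q`, `δ = 0`, `φ = n − A − q`, `ω = A + B − n`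
      exact ⟨z, p, 0, q, 0, A - p, n - A - q, 0, A + B - n, hz, hp, le_rfl, hq, le_rfl,
        by linarith, by linarith, le_rfl, by linarith, rfl, by ring, by ring, by ring, by ring,
        by ring⟩
    · -- `γ = n − A`, `δ = q − (n − A)`, `φ = 0`, `ω = B − q`
      exact ⟨z, p, 0, n - A, q - (n - A), A - p, 0, 0, B - q, hz, hp, le_rfl, by linarith,
        by linarith, by linarith, le_rfl, le_rfl, by linarith, rfl, by ring, by ring, by ring,
        by ring, by ring⟩

section Rays

variable {z p q n A B : K} (h : MemKCF z p q n A B)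
include h

/-- The inequality of a generator of `K_CF` against the ray `r₁ = (1,0,0,0,0,0)` (the identity):
`3t + z ≤ (z+p) + (z+q) + (t+A) + (t+B)`, i.e. `n ≤ A + B`. -/
theorem prodCF_ray₁ :
    3 * (z + p + q + n) + z ≤ (z + p) + (z + q) + (z + p + q + n + A) + (z + p + q + n + B) := by
  have := h.n_le; linarith

/-- Against `r₂ = (0,1,0,1,1,0)`: `6t ≤ (z+p) + 3(t+A) + 2(t+B)`, i.e. `q + n ≤ 3A + 2B`. -/
theorem prodCF_ray₂ :
    3 * ((z + p + q + n) * 2) ≤ (z + p) + 3 * (z + p + q + n + A) + 2 * (z + p + q + n + B) := by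
  have := h.q_le; have := h.n_le; have := h.A_nonneg; linarith

/-- Against `r₃ = (0,1,0,0,1,0)`: `3t ≤ (z+p) + 2(t+A) + (t+B)`. -/
theorem prodCF_ray₃ :
    3 * (z + p + q + n) ≤ (z + p) + 2 * (z + p + q + n + A) + (z + p + q + n + B) := by
  have := h.z_nonneg; have := h.p_nonneg; have := h.A_nonneg; have := h.B_nonneg; linarith

/-- Against `r₄ = (0,0,1,1,0,1)`: `6t ≤ (z+q) + 2(t+A) + 3(t+B)`, i.e. `p + n ≤ 2A + 3B`. -/
theorem prodCF_ray₄ :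
    3 * ((z + p + q + n) * 2) ≤ (z + q) + 2 * (z + p + q + n + A) + 3 * (z + p + q + n + B) := by
  have := h.p_le; have := h.n_le; have := h.B_nonneg; linarith

/-- Against `r₅ = (0,0,1,0,0,1)`: `3t ≤ (z+q) + (t+A) + 2(t+B)`. -/
theorem prodCF_ray₅ :
    3 * (z + p + q + n) ≤ (z + q) + (z + p + q + n + A) + 2 * (z + p + q + n + B) := by
  have := h.z_nonneg; have := h.q_nonneg; have := h.A_nonneg; have := h.B_nonneg; linarith

/-- Against `r₆ = (0,0,0,1,1,0)`: `3t ≤ 2(t+A) + (t+B)`. -/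
theorem prodCF_ray₆ : 3 * (z + p + q + n) ≤ 2 * (z + p + q + n + A) + (z + p + q + n + B) := by
  have := h.A_nonneg; have := h.B_nonneg; linarith

/-- Against `r₇ = (0,0,0,1,0,1)`: `3t ≤ (t+A) + 2(t+B)`. -/
theorem prodCF_ray₇ : 3 * (z + p + q + n) ≤ (z + p + q + n + A) + 2 * (z + p + q + n + B) := by
  have := h.A_nonneg; have := h.B_nonneg; linarith

/-- Against `r₈ = (0,0,0,0,1,0)`: `0 ≤ t + A`. -/
theorem prodCF_ray₈ : 0 ≤ z + p + q + n + A := by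
  have := h.z_nonneg; have := h.p_nonneg; have := h.q_nonneg; have := h.n_nonneg
  have := h.A_nonneg; linarith

/-- Against `r₉ = (0,0,0,0,0,1)`: `0 ≤ t + B`. -/
theorem prodCF_ray₉ : 0 ≤ z + p + q + n + B := by
  have := h.z_nonneg; have := h.p_nonneg; have := h.q_nonneg; have := h.n_nonneg
  have := h.B_nonneg; linarith

end Rays

/-- **THEOREM PROD-CF for two generators** (mine-3, `MINE3-PRODUCT.md` §2b): for
`(z, p, q, n, A, B), (z', p', q', n', A', B') ∈ K_CF`, with `t = z + p + q + n` and `t'` alike,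
`3·tt' + zz' ≤ (z+p)(z'+p') + (z+q)(z'+q') + (t+A)(t'+A') + (t+B)(t'+B')` — that is
`N ≤ 𝒜 + ℬ` for the count triple `N = tt' − (z+p)(z'+p') − (z+q)(z'+q') + zz'`,
`𝒜 = (t+A)(t'+A') − tt'`, `ℬ = (t+B)(t'+B') − tt'` of the product. Proof: the left-minus-right is
linear in the second generator, which is a nonnegative combination of the nine rays
(`exists_ray_decomposition`), and against each ray the inequality is one of the nine linear facts
`prodCF_ray₁ … prodCF_ray₉`. -/
theorem prodCF_two {z p q n A B z' p' q' n' A' B' : K} (h : MemKCF z p q n A B)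
    (h' : MemKCF z' p' q' n' A' B') :
    3 * ((z + p + q + n) * (z' + p' + q' + n')) + z * z' ≤
      (z + p) * (z' + p') + (z + q) * (z' + q') +
        (z + p + q + n + A) * (z' + p' + q' + n' + A') +
        (z + p + q + n + B) * (z' + p' + q' + n' + B') := by
  obtain ⟨c₁, c₂, c₃, c₄, c₅, c₆, c₇, c₈, c₉, hc₁, hc₂, hc₃, hc₄, hc₅, hc₆, hc₇, hc₈, hc₉,
    rfl, rfl, rfl, rfl, rfl, rfl⟩ := exists_ray_decomposition h'
  nlinarith [mul_nonneg hc₁ (sub_nonneg.2 (prodCF_ray₁ h)),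
    mul_nonneg hc₂ (sub_nonneg.2 (prodCF_ray₂ h)), mul_nonneg hc₃ (sub_nonneg.2 (prodCF_ray₃ h)),
    mul_nonneg hc₄ (sub_nonneg.2 (prodCF_ray₄ h)), mul_nonneg hc₅ (sub_nonneg.2 (prodCF_ray₅ h)),
    mul_nonneg hc₆ (sub_nonneg.2 (prodCF_ray₆ h)), mul_nonneg hc₇ (sub_nonneg.2 (prodCF_ray₇ h)),
    mul_nonneg hc₈ (prodCF_ray₈ h), mul_nonneg hc₉ (prodCF_ray₉ h)]

/-- **PROD-CF in the product coordinates** `(T, P, Q, Z, Mₐ, M_b) = (t, z+p, z+q, z, t+A, t+B)`: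
for two six-tuples satisfying the `K_CF` conditions in these coordinates — `0 ≤ Z ≤ P, Q`,
`P + Q ≤ T + Z` (`0 ≤ n`), `T ≤ Mₐ, M_b` (`0 ≤ A, B`), `P + T ≤ Mₐ + Z` (`p ≤ A`),
`Q + T ≤ M_b + Z` (`q ≤ B`) and `3T + Z ≤ P + Q + Mₐ + M_b` (`n ≤ A + B`) —
`3·TT' + ZZ' ≤ PP' + QQ' + MₐMₐ' + M_bM_b'`. For a marked multigraph these are the six counts of
`C026ProdCFGluing` (`T = #Apart`, `P = #{Apart ∧ b iso}`, `Q = #{Apart ∧ a iso}`,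
`Z = #{Apart ∧ IsBot}`, `Mₐ = #{b iso}`, `M_b = #{a iso}`) and the last hypothesis is (CF). -/
theorem prodCF_two' {T P Q Z Ma Mb T' P' Q' Z' Ma' Mb' : K}
    (hZ : 0 ≤ Z) (hZP : Z ≤ P) (hZQ : Z ≤ Q) (hn : P + Q ≤ T + Z) (hTA : T ≤ Ma) (hTB : T ≤ Mb)
    (hpA : P + T ≤ Ma + Z) (hqB : Q + T ≤ Mb + Z) (hCF : 3 * T + Z ≤ P + Q + Ma + Mb)
    (hZ' : 0 ≤ Z') (hZP' : Z' ≤ P') (hZQ' : Z' ≤ Q') (hn' : P' + Q' ≤ T' + Z') (hTA' : T' ≤ Ma')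
    (hTB' : T' ≤ Mb') (hpA' : P' + T' ≤ Ma' + Z') (hqB' : Q' + T' ≤ Mb' + Z')
    (hCF' : 3 * T' + Z' ≤ P' + Q' + Ma' + Mb') :
    3 * (T * T') + Z * Z' ≤ P * P' + Q * Q' + Ma * Ma' + Mb * Mb' := by
  have h : MemKCF Z (P - Z) (Q - Z) (T - P - Q + Z) (Ma - T) (Mb - T) :=
    ⟨hZ, by linarith, by linarith, by linarith, by linarith, by linarith, by linarith, by linarith,
      by linarith⟩
  have h' : MemKCF Z' (P' - Z') (Q' - Z') (T' - P' - Q' + Z') (Ma' - T') (Mb' - T') :=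
    ⟨hZ', by linarith, by linarith, by linarith, by linarith, by linarith, by linarith,
      by linarith, by linarith⟩
  have key := prodCF_two h h'
  ring_nf at key ⊢
  linarith

end ProdCF

end PercRepro
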